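import Mathlib
import Literature.NumberTheory.LFunctions.WeilExplicit

/-!
# PF persistence — the admissible class `𝒞` and the typed barrier landscape (pub-rhpf, barrier-typer)

**HONEST FRAMING. This is a long-odds MECHANISM SEARCH; no RH claims.** Nothing in this file is, or is
conditional progress toward, the Riemann Hypothesis. It TYPES the objects of the campaign's BARRIER ARM
("characterize the class `𝒞` of continuous computable functionals of finitely many truncated Weil operators and
show that no member of `𝒞` separates `ζ` from its negative controls unless it reads positivity itself") and PROVES
the elementary, RH-free parts of that landscape. Labels used in every docstring: **PROVED** (kernel-checked here,
RH-free), **TYPED** (a `def … : Prop`, to be used as a hypothesis `(h : X)`; nobody has proved it), **DATA**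
(a reading of the observatory dataset `pub-weilobs`, schema `weilobs.point/1`; never used in a proof).

## The objects (binding to the observatory schema and to Connes' certificate vocabulary)

* A **window** is `(a, N)`: test functions supported in `[-a, a]` (Connes' `λ = e^{a}`, `L = 2a = log x`), even
  block compressed to `span{ξ_0, ξ_1^+, …, ξ_N^+}` of Connes' trigonometric basis of `L²([-L/2, L/2])`
  (Connes–Consani arXiv:2106.01715 §2.1, Lemma 2.6; Connes–Consani–Moscovici arXiv:2511.22755 §5). The dataset's
  record key fields `a`, `N` (tier `window`).
* A **datum** `d : Datum` assigns to every window a real `(N+1) × (N+1)` matrix — the EVEN block of the truncated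
  Weil form. `ζ`'s datum `zetaDatum` is written in closed form exactly as in the `x = 13` certificate
  (`ConnesX13.Certificate`: `thetaEven`, `W02`, `WR`, `WP`, `qPlus`), with `L` and the prime-power WEIGHT TABLE
  `w : ℕ → ℝ` (`ζ`: `w q = Λ(q) q^{-1/2}` at position `log q`) as parameters. The ARITHMETIC DIAL SPACE
  `dialSpace = range datumOf` is the image of all weight tables: it contains the observatory's reweight / delete /
  `λ`-pert / two-sided `p`-dial control families (FRAMING §2's `D(𝒲)` restricted to integer positions; planted-zero,
  degree-2 and Epstein families are further members of the abstract domain `D`, which every theorem below takes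
  as a parameter).
* An **invariant / criterion** is a set `S : Set Datum` ("`F(d)` holds"). COMPUTABLE FROM THE SCHEMA means: membership
  of `d` depends on `d` only through the served fields of finitely many records, all of which are functions of the
  window matrices (tiers `window < spectral < eigvec < theta < decomp < m2 < polar < dlam < bd < heat < coupling` of
  `HOME/harness/hadmit.py`); the tier `operator` (the weight table itself) is NOT a function of finitely many window
  matrices and is outside `𝒞` by definition (escape door G-A). The Lean primitives are in §3.
* **Negatives**: `DetectablyNegative d` = some window matrix has a negative Rayleigh quotient. **Positive class**
  `𝒫 = {d | AllWindowsPositive d}`.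
* **Topologies** in which the controls are "small perturbations": `τ_fin` = agreement / closeness on finitely many
  windows (`FinitelyDetermined`, `FinitelyRobustAt`); `τ_unif` = quadratic-form closeness uniformly over all windows
  (`UniformlyClose ε`). The dial families are small in BOTH (PROVED: `uniformlyClose_dial`,
  `evenBlock_dial_of_not_mem`).

## The landscape (what is PROVED here or in the companion `PfPersistenceLocalityBarrier.lean` (§5–§7), what is TYPED)

* **T0 / F0 (PROVED, `pfPersistence_criterion_in_C_iff_weilPositivity`)**: for ANY class `𝒞 ∋ 𝒫` and any domain
  `D ∋ ζ`: "some `S ∈ 𝒞` contains `ζ` and no negative of `D`" `↔` "`ζ` is positive at all windows". Read literally the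
  charter's barrier is this tautology; all content is in the leaf-wise statements below. Under the TYPED Galerkin
  dictionary `GalerkinToContinuum` (+ the tree's even Weil criterion `riemannHypothesis_iff_evenWeilPositivity`) the
  right side implies RH (`riemannHypothesis_of_allWindowsPositive`).
* **LOCALITY BARRIER (PROVED, RH-free, `finitelyDetermined_meets_dialNegatives`)**: no criterion determined by
  finitely many windows — any value type, any resolution, any tier ≤ `coupling` — contains `ζ` and misses the
  negative part of the dial space: amplifying one prime power beyond the reach `e^{2a}` of the windows read leaves
  those windows' matrices IDENTICAL and makes a farther window negative. Closes every leaf `L1`/`Lk` for GLOBAL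
  separation ("don't look here"); per-window SOUNDNESS of `ε₁`-blind single-window functionals is the barrier-prover's
  dial lemma (FRAMING §3), not restated here.
* **UNIFORM-MODULUS BARRIER (PROVED modulo a TYPED accumulation input)**: no `τ_unif`-robust criterion contains `ζ`
  and misses the negatives of `D` once negatives of `D` accumulate at `ζ` uniformly
  (`not_uniformlyRobust_of_negativesAccumulate`); accumulation is PROVED for the full operator domain from the TYPED
  Galerkin upper law `GalerkinInfZero zetaDatum` (shift family `ζ − δ·1`), and TYPED for the dial space
  (prime-dial accumulation `NegativesAccumulate dialSpace zetaDatum`: the two-sided `p = 2` dial at the sign flip, DATA R-PF3a / PF-N2, scale `10^{0.6+2.1a} ε₁`; hypothesis of `not_separates_of_uniformlyRobust`).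
* **GAP CLASS G-U (TYPED, `IsWindowwiseOpen` with vanishing margin)**: all-window criteria that are open window by
  window but whose margin at `ζ` is not uniform in the window — contains strict positivity and one-signed-with-margin
  (`T1'`); not closed by either barrier; RH-strength is decided member-wise (a member inside `𝒫` or inside cofinal
  one-signedness implies RH by tree theorems). This is where an invariant, if any, lives.

## Re-type of 2026-08-19 (REFEREE r7 §1 vacuity finding; barrier-typer gen 2)

`Window` now carries the guard `ha : 0 < a` (v1 had junk windows `a ≤ 0` at which `ζ`'s `(0,0)` entry is
negative RH-independently, so `DetectablyNegative zetaDatum` was provable and T0 / the locality barrier were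
satisfiable by `d := zetaDatum`). With the guard: `AllWindowsPositive zetaDatum` is the Galerkin form of Weil
positivity (no RH-free decision either way is known), `GalerkinInfZero zetaDatum` / `NegativesAccumulate` /
the barrier-prover's `DialReady` are genuine hypotheses, and the companion file's barrier conclusions name a witness
`d ≠ zetaDatum` (`finitelyDetermined_meets_dialNegatives`, `not_uniformlyRobust_of_negativesAccumulateNe`).
T0 keeps its text and its honest label: a bookkeeping equivalence whose two sides are both open.
-/

set_option linter.dupNamespace false  -- the mandated namespace repeats `RiemannHypothesis`

noncomputable section

open Real MeasureTheory intervalIntegral Finset Matrix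

namespace Summit.RiemannHypothesis.RiemannHypothesis.Theorems.PfPersistence

/-! ## §1 Windows, data, weight tables, the `ζ` datum -/

/-- A WINDOW of the observatory: half-length `a > 0` of the test-function support `[-a, a]` (`L = 2a`) and the
truncation rank `N` of the even block. Schema fields `a`, `N` (tier `window`; every served record has `a > 0`).
The GUARD `ha : 0 < a` is part of the structure (REFEREE r7 §1, 2026-08-19: without it the junk "windows"
`a ≤ 0` — where `θ_{00}(y) = (L − y)/L` with `L ≤ 0` makes the `(0,0)` entry of `ζ`'s block `≤ −|L| − κ_L < 0` —
made `DetectablyNegative zetaDatum` TRUE and `AllWindowsPositive zetaDatum` FALSE independently of RH, and every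
barrier conclusion satisfiable by `d := zetaDatum`; with the guard `Datum` and all downstream `Prop`s keep their
text and regain their intended meaning). [folklore] -/
structure Window where
  /-- half-length of the support window -/
  a : ℝ
  /-- truncation rank: the even block lives on `span{ξ_0, …, ξ_N}` -/
  N : ℕ
  /-- the window is GENUINE: positive half-length (schema: every served `a` is `> 0`) -/
  ha : 0 < a

/-- The DATA SPACE: a real `(N+1) × (N+1)` matrix (even block of the truncated Weil form) at every window. [folklore] -/
abbrev Datum : Type := (win : Window) → Matrix (Fin (win.N + 1)) (Fin (win.N + 1)) ℝ

/-- A prime-power WEIGHT TABLE: weight `w q` carried at position `log q`. [folklore] -/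
abbrev Weights : Type := ℕ → ℝ

/-- `ζ`'s weight table `Λ(q) q^{-1/2}`. [folklore] -/
def zetaWeights : Weights := fun q => (ArithmeticFunction.vonMangoldt q : ℝ) * (q : ℝ) ^ (-(1 / 2 : ℝ))

/-- `κ_L = γ + log (4π tanh(L/2))` (coefficient of `Θ(0)` in `W_R` for support cut at `L`; `ConnesX13.kappaL`). [folklore] -/
def kappaL (L : ℝ) : ℝ := Real.eulerMascheroniConstant + Real.log (4 * π * Real.tanh (L / 2))

/-- `θ_{ξ_n, ξ_m}` for the even block on `0 ≤ y ≤ L` (Connes–Consani Lemma 2.6; `ConnesX13.thetaEven` with `L` a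
parameter; Connes–Consani arXiv:2106.01715 Lemma 2.6). [folklore] -/
def thetaEven (L : ℝ) (n m : ℕ) (y : ℝ) : ℝ :=
  if n = 0 ∧ m = 0 then (L - y) / L
  else if n = 0 then -Real.sin (2 * π * m * y / L) / (Real.sqrt 2 * π * m)
  else if m = 0 then -Real.sin (2 * π * n * y / L) / (Real.sqrt 2 * π * n)
  else if n = m then (L - y) / L * Real.cos (2 * π * n * y / L) - Real.sin (2 * π * n * y / L) / (2 * π * n)
  else ((n : ℝ) * Real.sin (2 * π * n * y / L) - (m : ℝ) * Real.sin (2 * π * m * y / L)) /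
    (π * ((m : ℝ) ^ 2 - (n : ℝ) ^ 2))

/-- Polar part `W_{0,2}(Θ) = 4 ∫_0^L Θ(y) cosh(y/2) dy` (even `Θ`). [folklore] -/
def W02 (L : ℝ) (Θ : ℝ → ℝ) : ℝ := 4 * ∫ y in (0:ℝ)..L, Θ y * Real.cosh (y / 2)

/-- Archimedean part `W_R(Θ) = κ_L Θ(0) + ∫_0^L (Θ(y) e^{y/2} − Θ(0)) / sinh y dy`. [folklore] -/
def WR (L : ℝ) (Θ : ℝ → ℝ) : ℝ :=
  kappaL L * Θ 0 + ∫ y in (0:ℝ)..L, (Θ y * Real.exp (y / 2) - Θ 0) / Real.sinh y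

/-- The prime powers that meet a support of length `L`: `q ≤ e^{L}`, i.e. `log q ≤ L`. [folklore] -/
def primeRange (L : ℝ) : Finset ℕ := Finset.range (⌊Real.exp L⌋₊ + 1)

/-- Prime part `Σ_p W_p(Θ) = 2 Σ_{log q ≤ L} w(q) Θ(log q)` for the weight table `w`. [folklore] -/
def WP (L : ℝ) (w : Weights) (Θ : ℝ → ℝ) : ℝ := 2 * ∑ q ∈ primeRange L, w q * Θ (Real.log q)

/-- Weil's functional `W = W_{0,2} − W_R − Σ_p W_p` of the weight table `w` on an even `Θ` given on `[0, L]`. [folklore] -/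
def weil (L : ℝ) (w : Weights) (Θ : ℝ → ℝ) : ℝ := W02 L Θ - WR L Θ - WP L w Θ

/-- The EVEN BLOCK at window `win` of the weight table `w`: `(n, m) ↦ W(θ_{ξ_n, ξ_m})` with `L = 2a`
(`ConnesX13.qPlus` is the case `a = (log 13)/2`, `N = 100`, `w = zetaWeights`). [folklore] -/
def evenBlock (w : Weights) (win : Window) : Matrix (Fin (win.N + 1)) (Fin (win.N + 1)) ℝ :=
  fun n m => weil (2 * win.a) w (thetaEven (2 * win.a) n m)

/-- Same with the three parts kept apart (schema tier `decomp`: `q_polar`, `q_arch`, `q_primes`). [folklore] -/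
def polarBlock (win : Window) : Matrix (Fin (win.N + 1)) (Fin (win.N + 1)) ℝ :=
  fun n m => W02 (2 * win.a) (thetaEven (2 * win.a) n m)

/-- archimedean block, see `polarBlock`. [folklore] -/
def archBlock (win : Window) : Matrix (Fin (win.N + 1)) (Fin (win.N + 1)) ℝ :=
  fun n m => WR (2 * win.a) (thetaEven (2 * win.a) n m)

/-- prime block of the weight table `w`, see `polarBlock`. [folklore] -/
def primesBlock (w : Weights) (win : Window) : Matrix (Fin (win.N + 1)) (Fin (win.N + 1)) ℝ :=
  fun n m => WP (2 * win.a) w (thetaEven (2 * win.a) n m)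

/-- PROVED: `evenBlock = polarBlock − archBlock − primesBlock`. [folklore] -/
theorem evenBlock_eq_decomp (w : Weights) (win : Window) :
    evenBlock w win = polarBlock win - archBlock win - primesBlock w win := by
  ext n m
  simp [evenBlock, polarBlock, archBlock, primesBlock, weil, Matrix.sub_apply]

/-- The datum of a weight table (all windows at once). [folklore] -/
def datumOf (w : Weights) : Datum := fun win => evenBlock w win

/-- `ζ`'s datum: the even blocks of the truncated Weil quadratic form of `ζ` at every window. [folklore] -/
def zetaDatum : Datum := datumOf zetaWeights

/-- The ARITHMETIC DIAL SPACE: data of all weight tables (contains reweight / delete / `λ`-pert / two-sided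
`p`-dial families; FRAMING §2's `D(𝒲)` with integer positions). [folklore] -/
def dialSpace : Set Datum := Set.range datumOf

/-- PROVED: `ζ ∈ dialSpace`. [folklore] -/
theorem zetaDatum_mem_dialSpace : zetaDatum ∈ dialSpace := ⟨zetaWeights, rfl⟩

/-! ## §2 Positivity, negatives, closeness, robustness -/

/-- A window matrix is POSITIVE: every Rayleigh quotient is `≥ 0` (schema: `eps1_even ≥ 0`). [folklore] -/
def WindowPositive {n : ℕ} (M : Matrix (Fin n) (Fin n) ℝ) : Prop := ∀ v : Fin n → ℝ, 0 ≤ v ⬝ᵥ (M *ᵥ v)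

/-- ALL-WINDOW POSITIVITY of a datum (the positive class `𝒫`). [folklore] -/
def AllWindowsPositive (d : Datum) : Prop := ∀ win, WindowPositive (d win)

/-- The positive class `𝒫 = {d | AllWindowsPositive d}`. [folklore] -/
def positiveClass : Set Datum := {d | AllWindowsPositive d}

/-- DETECTABLY NEGATIVE: some window matrix has a negative Rayleigh quotient (schema: `eps1_even < 0` at some
served record). [folklore] -/
def DetectablyNegative (d : Datum) : Prop := ∃ win, ∃ v : Fin (win.N + 1) → ℝ, v ⬝ᵥ (d win *ᵥ v) < 0

/-- PROVED: negative = not all-window positive. [folklore] -/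
theorem detectablyNegative_iff_not_allWindowsPositive (d : Datum) :
    DetectablyNegative d ↔ ¬ AllWindowsPositive d := by
  simp only [DetectablyNegative, AllWindowsPositive, WindowPositive, not_forall, not_le]

/-- A criterion `S` SEPARATES `d₀` from the negatives of the domain `D`: `d₀ ∈ S` and no detectably negative
member of `D` is in `S` (FRAMING: "`ζ ✓`, every negative control `✗`"). [folklore] -/
def Separates (S D : Set Datum) (d₀ : Datum) : Prop := d₀ ∈ S ∧ ∀ d ∈ D, DetectablyNegative d → d ∉ S

/-- `τ_fin`: `S` is DETERMINED BY FINITELY MANY WINDOWS — membership depends on the datum only through its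
matrices at a finite set of windows (every functional of finitely many served records, whatever its value type
or resolution; tiers ≤ `coupling`). [folklore] -/
def FinitelyDetermined (S : Set Datum) : Prop :=
  ∃ W : Finset Window, ∀ d d' : Datum, (∀ win ∈ W, d win = d' win) → (d ∈ S ↔ d' ∈ S)

/-- `τ_fin`-ROBUST AT `d₀`: some finite set of windows and some `ε > 0` such that every datum entrywise
`ε`-close to `d₀` on those windows lies in `S` (a functional of finitely many records, CONTINUOUS, holding at
`d₀` with a margin). [folklore] -/
def FinitelyRobustAt (S : Set Datum) (d₀ : Datum) : Prop :=
  ∃ W : Finset Window, ∃ ε : ℝ, 0 < ε ∧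
    ∀ d : Datum, (∀ win ∈ W, ∀ i j, |d win i j - d₀ win i j| < ε) → d ∈ S

/-- PROVED: a `τ_fin`-robust criterion contains a finitely determined criterion containing `d₀`
(shrink to the basic neighbourhood). [folklore] -/
theorem FinitelyRobustAt.exists_finitelyDetermined {S : Set Datum} {d₀ : Datum} (h : FinitelyRobustAt S d₀) :
    ∃ S' : Set Datum, S' ⊆ S ∧ d₀ ∈ S' ∧ FinitelyDetermined S' := by
  obtain ⟨W, ε, hε, hS⟩ := h
  refine ⟨{d | ∀ win ∈ W, ∀ i j, |d win i j - d₀ win i j| < ε}, fun d hd => hS d hd, ?_, ⟨W, ?_⟩⟩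
  · intro win _ i j
    simpa using hε
  · intro d d' hdd'
    simp only [Set.mem_setOf_eq]
    constructor
    · intro hd win hwin i j
      rw [← hdd' win hwin]
      exact hd win hwin i j
    · intro hd win hwin i j
      rw [hdd' win hwin]
      exact hd win hwin i j

/-- `τ_unif`: UNIFORM quadratic-form closeness over ALL windows, `|vᵀ(d_w − d'_w) v| ≤ ε |v|²` — the topology in
which a perturbation of operator norm `≤ ε` at every window is small (the two-sided `p`-dial by a factor `1 ± t` is
`2 w(p) |t|`-close, `uniformlyClose_dial`). [folklore] -/
def UniformlyClose (ε : ℝ) (d d' : Datum) : Prop :=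
  ∀ win, ∀ v : Fin (win.N + 1) → ℝ, |v ⬝ᵥ ((d win - d' win) *ᵥ v)| ≤ ε * (v ⬝ᵥ v)

/-- `τ_unif`-ROBUST AT `d₀`: all data uniformly `ε`-close to `d₀` lie in `S`, for some `ε > 0` (a functional with
an `a`-UNIFORM modulus of continuity holding at `d₀` with a margin). [folklore] -/
def UniformlyRobustAt (S : Set Datum) (d₀ : Datum) : Prop :=
  ∃ ε : ℝ, 0 < ε ∧ ∀ d : Datum, UniformlyClose ε d₀ d → d ∈ S

/-- NEGATIVES OF `D` ACCUMULATE AT `d₀` (uniformly): for every `ε > 0` some detectably negative member of `D` is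
uniformly `ε`-close to `d₀`. [folklore] -/
def NegativesAccumulate (D : Set Datum) (d₀ : Datum) : Prop :=
  ∀ ε : ℝ, 0 < ε → ∃ d ∈ D, DetectablyNegative d ∧ UniformlyClose ε d₀ d

/-- NEGATIVES OF `D` OTHER THAN `d₀` ACCUMULATE AT `d₀` (uniformly): `NegativesAccumulate` with the witness NAMED
DISTINCT from `d₀` (content-in-statement form, REFEREE r7 §1: the accumulating negatives are genuine perturbations,
never `d₀` itself; for the shift family PROVED in the companion file, `negativesAccumulateNe_univ_of_galerkinInfZero`;
for the prime dials it follows from the barrier-prover's `exists_negative_dial_uniformlyClose` + `datumOf_dial_ne`).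
[folklore] -/
def NegativesAccumulateNe (D : Set Datum) (d₀ : Datum) : Prop :=
  ∀ ε : ℝ, 0 < ε → ∃ d ∈ D, d ≠ d₀ ∧ DetectablyNegative d ∧ UniformlyClose ε d₀ d

/-- PROVED: the named form implies the plain one. [folklore] -/
theorem NegativesAccumulateNe.negativesAccumulate {D : Set Datum} {d₀ : Datum}
    (h : NegativesAccumulateNe D d₀) : NegativesAccumulate D d₀ := by
  intro ε hε
  obtain ⟨d, hdD, -, hneg, hclose⟩ := h ε hε
  exact ⟨d, hdD, hneg, hclose⟩

/-- GALERKIN BOTTOM TENDS TO ZERO FROM BELOW ANY MARGIN: for every `δ > 0` some window has a Rayleigh quotient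
`< δ`. For `ζ` this is the Galerkin shadow of the tree's RH-free UPPER LAW `weilGroundEnergy_exp_exp_decay`
(`ε(a) → 0`), via Galerkin convergence; TYPED (hypothesis), not proved here. [folklore] -/
def GalerkinInfZero (d : Datum) : Prop :=
  ∀ δ : ℝ, 0 < δ → ∃ win, ∃ v : Fin (win.N + 1) → ℝ, v ⬝ᵥ (d win *ᵥ v) < δ * (v ⬝ᵥ v)

/-! ## §3 The primitives of `𝒞` (what a served field is a function of) -/

/-- `ε₁`: the bottom of the Rayleigh quotient of a window matrix (schema `eps1_even`; tier `spectral`). [folklore] -/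
def bottomRayleigh {n : ℕ} (M : Matrix (Fin n) (Fin n) ℝ) : ℝ :=
  sInf {r : ℝ | ∃ v : Fin n → ℝ, v ≠ 0 ∧ r = v ⬝ᵥ (M *ᵥ v) / (v ⬝ᵥ v)}

/-- a BOTTOM VECTOR (schema `u_even`; tier `eigvec`). [folklore] -/
def IsBottomVector {n : ℕ} (M : Matrix (Fin n) (Fin n) ℝ) (u : Fin n → ℝ) : Prop :=
  u ≠ 0 ∧ M *ᵥ u = bottomRayleigh M • u

/-- Connes' even trigonometric basis on `[-L/2, L/2]`: `ξ_0 = L^{-1/2}`, `ξ_n = (-1)^n (2/L)^{1/2} cos(2π n x/L)`. [folklore] -/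
def xiEven (L : ℝ) (n : ℕ) (x : ℝ) : ℝ :=
  if n = 0 then 1 / Real.sqrt L else (-1 : ℝ) ^ n * Real.sqrt (2 / L) * Real.cos (2 * π * n * x / L)

/-- the PROFILE `θ_u(x) = Σ_n u_n ξ_n(x)` of a coefficient vector (schema `theta_*` fields; tier `theta`). [folklore] -/
def profile (L : ℝ) {N : ℕ} (u : Fin (N + 1) → ℝ) (x : ℝ) : ℝ := ∑ n : Fin (N + 1), u n * xiEven L n x

/-- ONE-SIGNED profile on the window (schema `theta_sign_changes_even = 0`; the `T1` shadow S3-I1). [folklore] -/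
def OneSigned (L : ℝ) {N : ℕ} (u : Fin (N + 1) → ℝ) : Prop :=
  (∀ x ∈ Set.Icc (-(L / 2)) (L / 2), 0 ≤ profile L u x) ∨ (∀ x ∈ Set.Icc (-(L / 2)) (L / 2), profile L u x ≤ 0)

/-- ONE-SIGNED WITH MARGIN `m`: `|θ_u| ≥ m` on the window, one sign (schema `theta_min_even`; AMP margin `t*` of
PF-I1 is an `ε₁`-resolving proxy). [folklore] -/
def OneSignedMargin (L m : ℝ) {N : ℕ} (u : Fin (N + 1) → ℝ) : Prop :=
  (∀ x ∈ Set.Icc (-(L / 2)) (L / 2), m ≤ profile L u x) ∨ (∀ x ∈ Set.Icc (-(L / 2)) (L / 2), profile L u x ≤ -m)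

/-- The single-window criterion "bottom vector one-signed" lifted to data at window `win` (S3-I1 per window). [folklore] -/
def oneSignedAt (win : Window) : Set Datum :=
  {d | ∃ u, IsBottomVector (d win) u ∧ OneSigned (2 * win.a) u}

/-- PROVED: every single-window criterion of this shape is finitely determined (hence inside the locality
barrier's scope). [folklore] -/
theorem finitelyDetermined_of_window (win : Window)
    (P : Matrix (Fin (win.N + 1)) (Fin (win.N + 1)) ℝ → Prop) :
    FinitelyDetermined {d | P (d win)} := by
  refine ⟨{win}, fun d d' h => ?_⟩
  simp only [Set.mem_setOf_eq]
  rw [h win (Finset.mem_singleton_self win)]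

/-- PROVED: in particular for one-signedness of the bottom vector at one window. [folklore] -/
theorem finitelyDetermined_oneSignedAt (win : Window) : FinitelyDetermined (oneSignedAt win) :=
  finitelyDetermined_of_window win (fun M => ∃ u, IsBottomVector M u ∧ OneSigned (2 * win.a) u)

/-- ALL-WINDOW, WINDOW-WISE OPEN criteria: `S = {d | ∀ w, d_w ∈ U_w}` with every `U_w` open in the matrix topology
(strict positivity; simple bottom with one-signed margin `T1'`; …). The GAP CLASS G-U consists of such `S ∋ ζ`
missing the negatives of `D` whose margin at `ζ` is NOT uniform in the window (else `UniformlyRobustAt`, closed by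
the uniform-modulus barrier). TYPED carve; RH-strength decided member-wise. [folklore] -/
def IsWindowwiseOpen (S : Set Datum) : Prop :=
  ∃ U : (win : Window) → Set (Matrix (Fin (win.N + 1)) (Fin (win.N + 1)) ℝ),
    (∀ win, IsOpen (U win)) ∧ S = {d | ∀ win, d win ∈ U win}

/-! ## §4 T0 / F0: the charter's barrier statement, typed — and why it is a tautology (PROVED) -/

/-- **PROVED (T0)** `pfPersistence_criterion_in_C_iff_weilPositivity`, Galerkin form. For EVERY class `𝒞` of
criteria containing the positive class `𝒫` and EVERY domain `D ∋ ζ`: some member of `𝒞` separates `ζ` from the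
negatives of `D` iff `ζ` is positive at all windows. (`→`: `ζ ∈ D`, so if `ζ` were negative somewhere it would be a
negative of `D` inside `S`; `←`: take `S = 𝒫`.) Continuity / computability of `𝒞` play no role: the content of the
barrier is in the leaf-wise statements `finitelyDetermined_meets_dialNegatives`,
`not_uniformlyRobust_of_negativesAccumulate`. HONEST LABEL: a bookkeeping equivalence; since the re-type
(`Window.ha`) both sides are OPEN statements (the right side is Galerkin Weil positivity), neither is decided
here. [folklore] -/
theorem pfPersistence_criterion_in_C_iff_weilPositivity (𝒞 : Set (Set Datum)) (h𝒫 : positiveClass ∈ 𝒞)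
    (D : Set Datum) (hζ : zetaDatum ∈ D) :
    (∃ S ∈ 𝒞, Separates S D zetaDatum) ↔ AllWindowsPositive zetaDatum := by
  constructor
  · rintro ⟨S, -, hmem, hneg⟩
    by_contra h
    exact hneg zetaDatum hζ ((detectablyNegative_iff_not_allWindowsPositive _).2 h) hmem
  · intro hpos
    refine ⟨positiveClass, h𝒫, hpos, fun d _ hd hdS => ?_⟩
    exact (detectablyNegative_iff_not_allWindowsPositive d).1 hd hdS

/-- **TYPED (dictionary, `→` direction; meaningful at `d = zetaDatum`)** GALERKIN TO CONTINUUM: all-window positivity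
of the even blocks gives `Re W(g ⋆ g̃) ≥ 0` for every smooth compactly supported even real `g` (for `ζ`: Fourier
truncations `P_N g → g` with all derivatives for `g` supported inside `(-a, a)`, and `W` is continuous in that
topology). Not proved here; used only as a hypothesis. [folklore] -/
def GalerkinToContinuum (d : Datum) : Prop :=
  AllWindowsPositive d →
    ∀ g : ℝ → ℂ, Literature.NumberTheory.LFunctions.IsWeilTest g → (∀ t : ℝ, g (-t) = g t) →
      (∀ t : ℝ, (g t).im = 0) → 0 ≤ (Literature.NumberTheory.LFunctions.weilQuadratic g).re

/-- **PROVED (modulo the TYPED dictionary and the tree's even Weil criterion, passed by name)**: all-window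
positivity of `ζ`'s datum implies RH. Feed `hcrit := riemannHypothesis_iff_evenWeilPositivity`
(`Theorems/RuelleBandExactFirstBandStubEvenCriterion.lean`). So every criterion class whose separating member sits
inside `𝒫` is RH-strength ("RH in disguise" at the global level). [folklore] -/
theorem riemannHypothesis_of_allWindowsPositive (hdict : GalerkinToContinuum zetaDatum)
    (hcrit : RiemannHypothesis ↔
      ∀ g : ℝ → ℂ, Literature.NumberTheory.LFunctions.IsWeilTest g → (∀ t : ℝ, g (-t) = g t) →
        (∀ t : ℝ, (g t).im = 0) → 0 ≤ (Literature.NumberTheory.LFunctions.weilQuadratic g).re)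
    (hpos : AllWindowsPositive zetaDatum) : RiemannHypothesis :=
  hcrit.2 (hdict hpos)

end Summit.RiemannHypothesis.RiemannHypothesis.Theorems.PfPersistence

end
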